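import Literature.Probability.Percolation.FourArmGarbanCrossingEvent
import HarnessLib

/-!
# Garban's crossing variable: open and dual walks of the square decide `X`

Topic `Literature/Probability/Percolation`; proof-only support file for the named fact
`Garban2011_fourArm_multiscale` (`FourArmGarban.lean`; C. Garban, Appendix B of O. Schramm,
S. Smirnov, Ann. Probab. 39 (2011), Lemma B.1). Bond percolation on `ℤ²`. No definition, no named
fact.

The docking step of the proof of Lemma B.1 (the two displays before (B.6): given `C_j = 1` and
`Q_j` pivotal, "the two open arms are joined inside `Q_j` and `Q` is crossed, `X = 1`"; dually
`X = -1`) ends with an open walk of the square joining its left side to (a neighbour of) its right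
side, respectively with a dual-open walk of faces from above the square to below it. This file
turns such walks into the values `±1` of the interface rendering `crossingSign` of `X`
(`FourArmGarbanSeparationReduction.lean`), through the crossing event `squareReach`
(`FourArmGarbanCrossingEvent.lean`):

* `mem_bcBondConfig_squareDobrushin` — an `ω`-open lattice edge of the square with no endpoint
  on the dual-wired sides is open in the completed configuration;
  `squareReach_of_open_walk`, `squareReach_of_openConnIn` — **an open walk (open connection) of
  the square, off the dual-wired sides, from the left column to the column `{x₀ = L-1}` gives
  `squareReach`**;
* `not_squareReach_of_faceWalk`, `not_squareReach_of_dual_faceWalk` — **a walk of faces from a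
  face above the square (`f₁ = L`) to a face below it (`f₁ = -1`) through faces of
  `[0, L-2] × [-1, L]`, each step crossing an edge closed in the completed configuration
  (respectively a dual-open edge of `dualConfig ω`), excludes `squareReach`** (discrete Jordan
  curve theorem, `exists_dart_sepEdge_mem_edges`; no such step crosses a wired edge of the left
  column);
* `crossingSign_eq_one_iff`, `crossingSign_eq_neg_one_iff`, `crossingSign_eq_of_squareReach`,
  `crossingSign_eq_of_not_squareReach` — `X = 1 ↔ squareReach (4n)`, `X = -1 ↔ ¬ squareReach (4n)`.

## References

* O. Schramm, S. Smirnov (appendix by C. Garban), Ann. Probab. 39 (2011), Appendix B, proof of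
  Lemma B.1 [SchrammSmirnov2011].
* B. Bollobás, O. Riordan, *Percolation* (2006), Ch. 3, Lemma 1 [BollobasRiordan2006].

Tree: `squareReach`, `reveals_rightPairs_iff_squareReach`, `rightColumnPairs_eq`
(`FourArmGarbanCrossingEvent.lean`), `crossingSign`, `isZdAdmissible_square`
(`FourArmGarbanSeparationReduction.lean`), `squareDobrushin`, `squareSites`,
`mem_zdArcA_squareDobrushin_iff`, `mem_zdArcB_squareDobrushin_iff`,
`discreteDomainGraph_squareDomain_adj_iff` (`FourArmGarbanSquareDomain.lean`),
`DiscreteDobrushin.mem_bcBondConfig_iff` (`MedialInterface.lean`), `exists_dart_sepEdge_mem_edges`,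
`dualEdge_sepEdge`, `sepEdge`, `sepLo`, `sepHi`, `exists_walk_of_mem_openConnIn`
(`PlanarDuality.lean`), `mem_dualConfig_iff` (`Crossings.lean`).
-/

noncomputable section

namespace Literature.Probability.Percolation

open _root_.MeasureTheory Set LatticeModels LatticeModels.DiscreteDobrushin

/-! ### Open walks of the square give `squareReach` -/

/-- An `ω`-open lattice edge between sites of the square none of which is on the dual-wired sides
is open in the completed configuration of `squareDobrushin L`. [folklore] -/
theorem mem_bcBondConfig_squareDobrushin {L : ℕ} {ω : BondConfig (Site 2)} {x y : Site 2}
    (hxy : (zdGraph 2).Adj x y) (hx : x ∈ squareSites L) (hy : y ∈ squareSites L)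
    (hxB : x ∉ (squareDobrushin L).zdArcB) (hyB : y ∉ (squareDobrushin L).zdArcB) (hω : s(x, y) ∈ ω) :
    s(x, y) ∈ (squareDobrushin L).bcBondConfig ω := by
  refine ⟨?_, Or.inr ⟨hω, fun z hz => ?_⟩⟩
  · rw [SimpleGraph.mem_edgeSet, squareDobrushin_Ω, squareDobrushin_δ, discreteDomainGraph_squareDomain_adj_iff]
    exact ⟨hxy, hx, hy⟩
  · rcases Sym2.mem_iff.1 hz with rfl | rfl
    · exact hxB
    · exact hyB

/-- A site of the square off the dual-wired sides is off the right column. [folklore] -/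
theorem apply_zero_lt_of_not_mem_zdArcB {L : ℕ} (hL : 1 ≤ L) {z : Site 2} (hz : z ∈ squareSites L)
    (hzB : z ∉ (squareDobrushin L).zdArcB) : z 0 + 1 ≤ L := by
  rw [mem_zdArcB_squareDobrushin_iff hL] at hzB
  have h0 := (mem_squareSites_iff.1 hz) 0
  by_contra h
  exact hzB ⟨⟨hz, 0, Or.inr (by omega)⟩, by omega⟩

/-- **An open walk of the square from the left column to `{x₀ = L-1}` gives `squareReach`.**
[cite: SchrammSmirnov2011, Appendix B, proof of Lemma B.1 (X = 1 when Q is crossed)] -/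
theorem squareReach_of_open_walk {L : ℕ} (hL : 1 ≤ L) {ω : BondConfig (Site 2)} {a b : Site 2}
    (p : (zdGraph 2).Walk a b) (ha : a 0 = 0) (hb : b 0 + 1 = L)
    (hs : ∀ z ∈ p.support, z ∈ squareSites L ∧ z ∉ (squareDobrushin L).zdArcB)
    (hp : ∀ e ∈ p.edges, e ∈ ω) : squareReach L ω := by
  refine ⟨a, b, p, ha, hb, fun z hz => ⟨(hs z hz).1, apply_zero_lt_of_not_mem_zdArcB hL (hs z hz).1 (hs z hz).2⟩,
    fun e he => ?_⟩
  -- the edge `e` has both endpoints on the walk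
  obtain ⟨d, hd, rfl⟩ := List.mem_map.1 (by rwa [SimpleGraph.Walk.edges] at he)
  have hx := hs _ (p.dart_fst_mem_support_of_mem_darts hd)
  have hy := hs _ (p.dart_snd_mem_support_of_mem_darts hd)
  exact mem_bcBondConfig_squareDobrushin d.adj hx.1 hy.1 hx.2 hy.2 (hp _ he)

/-- **An open connection of the square from the left column to `{x₀ = L-1}` gives `squareReach`**
(`openConnIn` form, for a lattice configuration). [cite: SchrammSmirnov2011, Appendix B, proof of Lemma B.1 (X = 1 when Q is crossed)] -/
theorem squareReach_of_openConnIn {L : ℕ} (hL : 1 ≤ L) {ω : BondConfig (Site 2)}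
    (hω : ω ⊆ (zdGraph 2).edgeSet) {S : Set (Site 2)}
    (hS : ∀ z ∈ S, z ∈ squareSites L ∧ z ∉ (squareDobrushin L).zdArcB) {a b : Site 2}
    (ha : a 0 = 0) (hb : b 0 + 1 = L) (h : ω ∈ openConnIn S a b) : squareReach L ω := by
  obtain ⟨p, hpS, hpω⟩ := exists_walk_of_mem_openConnIn hω h
  exact squareReach_of_open_walk hL p ha hb (fun z hz => hS z (hpS z hz)) hpω

/-! ### Dual walks of faces across the square exclude `squareReach` -/

/-- **A top-to-bottom walk of faces through closed edges excludes `squareReach`** (discrete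
Jordan curve theorem): faces in `[0, L-2] × [-1, L]`, from a face with `f₁ = L` to a face with
`f₁ = -1`, every step crossing an edge closed in the completed configuration.
[cite: BollobasRiordan2006, Ch. 3 Lemma 1] -/
theorem not_squareReach_of_faceWalk {L : ℕ} (hL : 2 ≤ L) {ω : BondConfig (Site 2)} {t s : Site 2}
    (Q : (zdGraph 2).Walk t s) (ht : t 1 = L) (hs : s 1 = -1)
    (hQ : ∀ z ∈ Q.support, 0 ≤ z 0 ∧ z 0 + 2 ≤ L ∧ -1 ≤ z 1 ∧ z 1 ≤ L)
    (hclosed : ∀ d ∈ Q.darts, sepEdge d.fst d.snd ∉ (squareDobrushin L).bcBondConfig ω) :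
    ¬ squareReach L ω := by
  rintro ⟨a, b, P, ha, hb, hPs, hPe⟩
  have hL1 : ((L - 1 : ℕ) : ℤ) = (L : ℤ) - 1 := by push_cast [Nat.cast_sub (by omega : 1 ≤ L)]; ring
  have hPs' : ∀ z ∈ P.support, 0 ≤ z 0 ∧ z 0 ≤ ((L - 1 : ℕ) : ℤ) ∧ 0 ≤ z 1 ∧ z 1 ≤ (L : ℤ) := by
    intro z hz
    obtain ⟨hzS, hzL⟩ := hPs z hz
    have h0 := (mem_squareSites_iff.1 hzS) 0
    have h1 := (mem_squareSites_iff.1 hzS) 1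
    rw [hL1]; omega
  have hQ' : ∀ z ∈ Q.support, 0 ≤ z 0 ∧ z 0 + 1 ≤ ((L - 1 : ℕ) : ℤ) ∧ -1 ≤ z 1 ∧ z 1 ≤ (L : ℤ) := by
    intro z hz
    have := hQ z hz
    rw [hL1]; omega
  obtain ⟨dq, hdq, hsep⟩ := exists_dart_sepEdge_mem_edges (M := L - 1) (N := L) P Q hPs' hQ' ha
    (by rw [hL1]; omega) ht hs
  exact hclosed dq hdq (hPe _ hsep)

/-- No step between faces with `f₀ ≥ 0` crosses a wired edge of the left column: the separating
edge of two such adjacent faces does not have both endpoints on `{x₀ = 0}`. [folklore] -/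
theorem not_forall_mem_sepEdge_apply_zero_eq_zero {z z' : Site 2} (h : (zdGraph 2).Adj z z')
    (hz : 0 ≤ z 0) (hz' : 0 ≤ z' 0) : ¬ ∀ x ∈ sepEdge z z', x 0 = 0 := by
  intro hall
  have hlo := hall (sepLo z z') (Sym2.mem_mk_left _ _)
  have hhi := hall (sepHi z z') (Sym2.mem_mk_right _ _)
  have hlo0 : sepLo z z' 0 = max (z 0) (z' 0) := by
    show (z ⊔ z') 0 = _
    rw [Pi.sup_apply]
  unfold sepHi at hhi
  simp only [Pi.add_apply] at hhi
  split_ifs at hhi with h0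
  · simp at hhi; omega
  · -- horizontally adjacent faces: `z 0 ≠ z' 0`, both `≥ 0`, so the max is positive
    have : max (z 0) (z' 0) = 0 := by rw [← hlo0]; exact hlo
    rcases (zdGraph_adj_iff z z').1 h with ⟨j, hj | hj⟩
    · have := congrFun hj 0
      simp only [Pi.add_apply, Pi.single_apply] at this
      split_ifs at this with hj0 <;> omega
    · have := congrFun hj 0
      simp only [Pi.add_apply, Pi.single_apply] at this
      split_ifs at this with hj0 <;> omega

/-- **A top-to-bottom dual-open walk of faces excludes `squareReach`**: as
`not_squareReach_of_faceWalk`, with every step a dual-open edge of `dualConfig ω` (the edge it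
crosses is then `ω`-closed and, not being a wired left-column edge, closed in the completed
configuration). [cite: SchrammSmirnov2011, Appendix B, proof of Lemma B.1 (X = -1 when the dual arms are joined)] -/
theorem not_squareReach_of_dual_faceWalk {L : ℕ} (hL : 2 ≤ L) {ω : BondConfig (Site 2)} {t s : Site 2}
    (Q : (zdGraph 2).Walk t s) (ht : t 1 = L) (hs : s 1 = -1)
    (hQ : ∀ z ∈ Q.support, 0 ≤ z 0 ∧ z 0 + 2 ≤ L ∧ -1 ≤ z 1 ∧ z 1 ≤ L)
    (hdual : ∀ e ∈ Q.edges, e ∈ dualConfig ω) : ¬ squareReach L ω := by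
  refine not_squareReach_of_faceWalk hL Q ht hs hQ fun d hd hbc => ?_
  have hedge : s(d.fst, d.snd) ∈ dualConfig ω :=
    hdual _ (by rw [SimpleGraph.Walk.edges]; exact List.mem_map.2 ⟨d, hd, rfl⟩)
  rcases ((DiscreteDobrushin.mem_bcBondConfig_iff (D := squareDobrushin L)).1 hbc).2 with hA | ⟨hω, -⟩
  · -- a wired `A`–`A` edge: both endpoints on the left column, impossible for faces with `f₀ ≥ 0`
    have hz := hQ _ (Q.dart_fst_mem_support_of_mem_darts hd)
    have hz' := hQ _ (Q.dart_snd_mem_support_of_mem_darts hd)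
    exact not_forall_mem_sepEdge_apply_zero_eq_zero d.adj hz.1 hz'.1 fun x hx =>
      ((mem_zdArcA_squareDobrushin_iff (by omega)).1 (hA x hx)).2
  · exact (mem_dualConfig_iff.1 hedge).2 _ hω (dualEdge_sepEdge d.adj)

/-! ### The values of `X` -/

/-- `X = 1` iff the square is crossed. [cite: SchrammSmirnov2011, Appendix B, proof of Lemma B.1 (X = 2·1_{Q crossed} - 1)] -/
theorem crossingSign_eq_one_iff (n : ℕ) (hn : 1 ≤ n) (ω : BondConfig (Site 2)) :
    crossingSign n hn ω = 1 ↔ squareReach (4 * n) ω := by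
  have key : ω ∈ Reveals (isZdAdmissible_square n hn) (rightColumnPairs n) ↔ squareReach (4 * n) ω :=
    reveals_rightPairs_iff_squareReach (L := 4 * n) (by omega) ω
  classical
  unfold crossingSign
  rw [← key, Set.indicator_apply, Pi.one_apply]
  split_ifs with h
  · simp only [h, iff_true]; norm_num
  · simp only [h, iff_false]; norm_num

/-- `X = -1` iff the square is not crossed. [cite: SchrammSmirnov2011, Appendix B, proof of Lemma B.1 (X = 2·1_{Q crossed} - 1)] -/
theorem crossingSign_eq_neg_one_iff (n : ℕ) (hn : 1 ≤ n) (ω : BondConfig (Site 2)) :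
    crossingSign n hn ω = -1 ↔ ¬ squareReach (4 * n) ω := by
  have key : ω ∈ Reveals (isZdAdmissible_square n hn) (rightColumnPairs n) ↔ squareReach (4 * n) ω :=
    reveals_rightPairs_iff_squareReach (L := 4 * n) (by omega) ω
  classical
  unfold crossingSign
  rw [← key, Set.indicator_apply, Pi.one_apply]
  split_ifs with h
  · simp only [h, not_true_eq_false, iff_false]; norm_num
  · simp only [h, not_false_eq_true, iff_true]; norm_num

/-- `X = 1` on `squareReach`. [cite: SchrammSmirnov2011, Appendix B, proof of Lemma B.1] -/
theorem crossingSign_eq_of_squareReach {n : ℕ} (hn : 1 ≤ n) {ω : BondConfig (Site 2)}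
    (h : squareReach (4 * n) ω) : crossingSign n hn ω = 1 :=
  (crossingSign_eq_one_iff n hn ω).2 h

/-- `X = -1` off `squareReach`. [cite: SchrammSmirnov2011, Appendix B, proof of Lemma B.1] -/
theorem crossingSign_eq_of_not_squareReach {n : ℕ} (hn : 1 ≤ n) {ω : BondConfig (Site 2)}
    (h : ¬ squareReach (4 * n) ω) : crossingSign n hn ω = -1 :=
  (crossingSign_eq_neg_one_iff n hn ω).2 h

end Literature.Probability.Percolation
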